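import Summits.HodgeConjecture.CorCM.MultiFieldWeilTwoSimpleThreefoldsTwoAbsorbedCurves
import Summits.HodgeConjecture.CorCM.MultiFieldWeilSimpleThreefoldCurves
import HarnessLib

/-!
# MULTI-FIELD WEIL ENGINE — ANY TWO SIMPLE CM THREEFOLDS AND ANY FINITE FAMILY OF CM ELLIPTIC CURVES: the Hodge conjecture for every
# `T₀^a × T₁^b × ∏_c E_c^{n_c}`, given ONLY Markman's fourfold theorem

Cell `pub-hodgecm2` (COR-CM), seat b30 gen 34 (2026-08-24); count-neutral own lane MULTI-FIELD WEIL ENGINE (stem `MultiFieldWeil*`), sequel of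
`CorCM/MultiFieldWeilAnyTwoSimpleThreefoldsAnyCurve.lean` (two threefolds, ONE curve) and `CorCM/MultiFieldWeilTwoSimpleThreefoldsTwoAbsorbedCurves.lean` (two threefolds,
each with its own curve), in the style of gen 33's `CorCM/MultiFieldWeilSimpleThreefoldAnyCurves.lean` (ONE threefold, any curves).  Theorems only; no definition, no named
fact, no `sorry`.  HONEST FRAMING: conditional on the displayed Markman fourfold binder only; `HC_CM` is NOT proved and not asserted.

THE STATEMENT (**`hodgeConjectureFor_prod_two_simpleThreefolds_anyCurves_of_markman`**).  `T₀ ⊨ (K₀; Φ₀)`, `T₁ ⊨ (K₁; Φ₁)` ANY two SIMPLE CM abelian threefolds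
(sextic CM fields); `E_c ⊨ (k_c; Ψ_c)` (`c ∈ I`, finite) ANY CM elliptic curves — isogenous or not, nothing assumed on any field.  Then for every `π : Fin N → Fin 2 ⊕ I`
the Hodge conjecture holds for `⨁_j Sum.elim ![T₀, T₁] E (π j)` — every `T₀^a × T₁^b × ∏_c E_c^{n_c}` in any number and order — GIVEN ONLY
`Markman2025_weilClasses_algebraic_abelianFourfold`; with the dominated form.

PROOF.  One representative per isogeny class of curves (§3, as in gen 33's S10), so the curves are pairwise non-isogenous, i.e. their fields pairwise non-isomorphic
(§2).  A sextic CM field receives at most ONE of these imaginary quadratic fields (b16's `WeilFibre.nonempty_algEquiv_of_finrank_eq_two`: a field of degree not divisible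
by `4` has at most one quadratic subfield), so at most one curve `E_a` goes to `K₀` and at most one `E_b` to `K₁`; every other curve is FOREIGN to `K₀, K₁, k_a, k_b` and the
block of those splits off UNCONDITIONALLY (gen 33's `hodgeConjectureFor_prod_of_foreignCurves`; inside: Moonen–Zarhin Cor. (3.9), b16's
`hodgeConjectureFor_prod_of_pairwise_not_isIsogenous`).  The rest block `{T₀, T₁, E_a, E_b}` (§1, `hodgeConjectureFor_prod_sum_of_forall_ringHom_of_markman`): no
distinguished curve — gen 31's G5 (any two simple threefolds); one — the previous roof (two simple threefolds × any curve); two, `a ≠ b` — then `k_a ↪ K₀` only and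
`k_b ↪ K₁`, the two-absorbed-blocks theorem.

[cite: MoonenZarhin1999LowDim, Thm. (0.1) (a), Thm. (0.2), §3 (3.1), Cor. (3.9), §5 (5.2)] [cite: Markman2025SurveySecant, Thm. 1.2] [cite: Gordon1999HodgeAVSurvey, §3 Theorem (proof), 7.4–7.7]
[cite: Shimura1998, §6.1 Corollary of Theorem 2 (p. 41), §18.1] [cite: MumfordAV1970, §19 Thm. 1 and p. 169]

## References
* [MoonenZarhin1999LowDim] B. Moonen, Yu. Zarhin, Math. Ann. 315 (1999) 711–733.  [Markman2025SurveySecant] E. Markman, arXiv:2509.23403, Thm. 1.2.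
  [Gordon1999HodgeAVSurvey] B. B. Gordon, *A survey of the Hodge conjecture for abelian varieties*, §3, 7.4–7.7.  [Shimura1998] G. Shimura, *Abelian varieties with
  complex multiplication and modular functions*, §6.1, §18.1.  [MumfordAV1970] D. Mumford, *Abelian Varieties*, §19.
-/

noncomputable section

open CategoryTheory CategoryTheory.Limits NumberField IntermediateField

namespace Summit.HodgeConjecture.CorCM.MultiFieldWeil

open Literature.AlgebraicGeometry Literature.AlgebraicGeometry.Motives Literature.AlgebraicGeometry.HodgeTheory
open Literature.AlgebraicGeometry.ComplexMultiplication (IsCMTypeRealisation)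
open Literature.AlgebraicTopology.SingularHomology
open Literature.NumberTheory.ComplexMultiplication

open scoped Classical

section TwoThreefoldsCurves

variable {I : Type} [Fintype I] {kq : I → Type} [fk : ∀ a, Field (kq a)] [nk : ∀ a, NumberField (kq a)] [ck : ∀ a, IsCMField (kq a)]
  {E : I → AbelianVariety ℂ} {Ψ : ∀ a, CMType (kq a)} {ιE : ∀ a, 𝓞 (kq a) →+* End (E a)} {θE : ∀ a, kq a →+* Module.End ℂ (complexBetti (E a).X 1)}
  {K₀ K₁ : Type} [fK₀ : Field K₀] [nK₀ : NumberField K₀] [cK₀ : IsCMField K₀] [fK₁ : Field K₁] [nK₁ : NumberField K₁] [cK₁ : IsCMField K₁]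
  {T₀ T₁ : AbelianVariety ℂ} {Φ₀ : CMType K₀} {Φ₁ : CMType K₁} {ι₀ : 𝓞 K₀ →+* End T₀} {θ₀ : K₀ →+* Module.End ℂ (complexBetti T₀.X 1)}
  {ι₁ : 𝓞 K₁ →+* End T₁} {θ₁ : K₁ →+* Module.End ℂ (complexBetti T₁.X 1)}

/-! ## §1 The rest block: the two threefolds and the curves whose fields embed in `K₀` or `K₁` -/

omit [Fintype I] nk ck nK₀ cK₀ nK₁ cK₁ in
/-- The slots `inl i ↦ T_i`, `inr c ↦ E_c` with every curve slot equal to ONE curve `a`, read on `![T₀, T₁, E_a]` (bookkeeping). [folklore] -/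
theorem sum_elim_eq_vec_three {a : I} (s : Fin 2 ⊕ I) (hs : ∀ c, s = Sum.inr c → c = a) :
    (Sum.elim ![T₀, T₁] E s : AbelianVariety ℂ) = (![T₀, T₁, E a] : Fin 3 → AbelianVariety ℂ) (Sum.elim Fin.castSucc (fun _ => 2) s) := by
  rcases s with i | c
  · fin_cases i
    · rfl
    · rfl
  · cases hs c rfl
    rfl

omit [Fintype I] nk ck nK₀ cK₀ nK₁ cK₁ in
/-- The slots with every curve slot among TWO curves `a ≠ b`, read on `![T₀, T₁, E_a, E_b]` (bookkeeping). [folklore] -/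
theorem sum_elim_eq_vec_four {a b : I} (s : Fin 2 ⊕ I) (hs : ∀ c, s = Sum.inr c → c = a ∨ c = b) :
    (Sum.elim ![T₀, T₁] E s : AbelianVariety ℂ) =
      (![T₀, T₁, E a, E b] : Fin 4 → AbelianVariety ℂ) (Sum.elim (fun i => Fin.castSucc (Fin.castSucc i)) (fun c => if c = a then 2 else 3) s) := by
  rcases s with i | c
  · fin_cases i
    · rfl
    · rfl
  · simp only [Sum.elim_inr]
    by_cases hca : c = a
    · rw [if_pos hca]
      subst hca
      rfl
    · rw [if_neg hca]
      rcases hs c rfl with h | h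
      · exact absurd h hca
      · subst h
        rfl

omit [Fintype I] nk ck nK₀ cK₀ nK₁ cK₁ in
/-- The slots with NO curve slot, read on `![T₀, T₁]` (bookkeeping). [folklore] -/
theorem sum_elim_eq_vec_two (s : Fin 2 ⊕ I) (hs : ∀ c, s ≠ Sum.inr c) :
    (Sum.elim ![T₀, T₁] E s : AbelianVariety ℂ) = (![T₀, T₁] : Fin 2 → AbelianVariety ℂ) (Sum.elim id (fun _ => 0) s) := by
  rcases s with i | c
  · rfl
  · exact absurd rfl (hs c)

omit [Fintype I] in
/-- **At most one curve of a pairwise non-isogenous family goes to a sextic field**: if `k_a`, `k_b` both embed in `K` (`[K : ℚ] = 6`) then `k_a ≅ k_b` (a field of degree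
not divisible by `4` has at most one quadratic subfield, b16), so `E_a ∼ E_b` and `a = b`. [cite: Shimura1998, §18.1, §6.1 Corollary of Theorem 2 (p. 41)] -/
theorem eq_of_ringHom_of_ringHom_of_sextic {K : Type} [Field K] [NumberField K] (h6 : Module.finrank ℚ K = 6) (h2 : ∀ a, Module.finrank ℚ (kq a) = 2)
    (hE : ∀ a, IsCMTypeRealisation (Ψ a) (E a) (ιE a) (θE a)) (hni : ∀ a b, a ≠ b → ¬ AbelianVariety.IsIsogenous (E a) (E b)) {a b : I} (fa : kq a →+* K)
    (fb : kq b →+* K) : a = b := by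
  by_contra hab
  obtain ⟨e⟩ := WeilFibre.nonempty_algEquiv_of_finrank_eq_two (M := K) (h2 a) (h2 b) (by rw [h6]; decide) fa.toRatAlgHom fb.toRatAlgHom
  exact hni a b hab (isIsogenous_of_ringEquiv (h2 a) (hE a) (hE b) e.symm.toRingEquiv)

/-- **THE REST BLOCK.**  `T₀, T₁` simple CM threefolds, `E_c` pairwise non-isogenous CM elliptic curves, and a product of copies `⨁_l Sum.elim ![T₀, T₁] E (ρ l)` in which EVERY
curve slot `inr c` has `k_c ↪ K₀` or `k_c ↪ K₁`: the Hodge conjecture holds for it, GIVEN ONLY Markman's fourfold theorem.  At most one curve `a` goes to `K₀` and at most one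
`b` to `K₁` (`eq_of_ringHom_of_ringHom_of_sextic`); none: gen 31's G5; `a = b` or only one of them: the roof «two simple threefolds × any curve»; `a ≠ b`: `k_a ↪̸ K₁`, the
two-absorbed-blocks theorem on `![T₀, T₁, E_a, E_b]`. [cite: MoonenZarhin1999LowDim, Thm. (0.1) (a), §3 (3.1)] [cite: Markman2025SurveySecant, Thm. 1.2] [cite: Shimura1998, §18.1] -/
theorem hodgeConjectureFor_prod_sum_of_forall_ringHom_of_markman (hW4 : Markman2025_weilClasses_algebraic_abelianFourfold) (h6₀ : Module.finrank ℚ K₀ = 6)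
    (h6₁ : Module.finrank ℚ K₁ = 6) (hT₀ : IsCMTypeRealisation Φ₀ T₀ ι₀ θ₀) (hT₁ : IsCMTypeRealisation Φ₁ T₁ ι₁ θ₁) (hS₀ : T₀.IsSimple) (hS₁ : T₁.IsSimple)
    (h2 : ∀ a, Module.finrank ℚ (kq a) = 2) (hE : ∀ a, IsCMTypeRealisation (Ψ a) (E a) (ιE a) (θE a))
    (hni : ∀ a b, a ≠ b → ¬ AbelianVariety.IsIsogenous (E a) (E b)) {M : ℕ} (ρ : Fin M → Fin 2 ⊕ I)
    (hρ : ∀ l c, ρ l = Sum.inr c → Nonempty (kq c →+* K₀) ∨ Nonempty (kq c →+* K₁)) :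
    HodgeConjectureFor (⨁ fun l => (Sum.elim ![T₀, T₁] E (ρ l) : AbelianVariety ℂ)).dim (⨁ fun l => (Sum.elim ![T₀, T₁] E (ρ l) : AbelianVariety ℂ)).X := by
  by_cases hex₀ : ∃ a, Nonempty (kq a →+* K₀) <;> by_cases hex₁ : ∃ b, Nonempty (kq b →+* K₁)
  · obtain ⟨a, ⟨fa⟩⟩ := hex₀
    obtain ⟨b, ⟨fb⟩⟩ := hex₁
    by_cases hab : a = b
    · -- one distinguished curve `a`: the roof «two simple threefolds × any curve»
      subst hab
      have hs : ∀ l c, ρ l = Sum.inr c → c = a := fun l c h => by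
        rcases hρ l c h with hg | hg
        · exact eq_of_ringHom_of_ringHom_of_sextic h6₀ h2 hE hni hg.some fa
        · exact eq_of_ringHom_of_ringHom_of_sextic h6₁ h2 hE hni hg.some fb
      have hfun : (fun l => (Sum.elim ![T₀, T₁] E (ρ l) : AbelianVariety ℂ)) =
          fun l => (![T₀, T₁, E a] : Fin 3 → AbelianVariety ℂ) (Sum.elim Fin.castSucc (fun _ => 2) (ρ l)) := funext fun l => sum_elim_eq_vec_three (ρ l) (hs l)
      rw [hfun]
      exact hodgeConjectureFor_biproduct_comp_vec_of_any_two_simpleThreefolds_cmCurve_of_markman hW4 h6₀ h6₁ (h2 a) hT₀ hT₁ (hE a) hS₀ hS₁ _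
    · -- two distinguished curves `a ≠ b`: `k_a ↪ K₀` only, `k_b ↪ K₁` — the two absorbed blocks
      have haK₁ : IsEmpty (kq a →+* K₁) := ⟨fun g => hab (eq_of_ringHom_of_ringHom_of_sextic h6₁ h2 hE hni g fb)⟩
      have hs : ∀ l c, ρ l = Sum.inr c → c = a ∨ c = b := fun l c h => by
        rcases hρ l c h with hg | hg
        · exact Or.inl (eq_of_ringHom_of_ringHom_of_sextic h6₀ h2 hE hni hg.some fa)
        · exact Or.inr (eq_of_ringHom_of_ringHom_of_sextic h6₁ h2 hE hni hg.some fb)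
      have hfun : (fun l => (Sum.elim ![T₀, T₁] E (ρ l) : AbelianVariety ℂ)) = fun l => (![T₀, T₁, E a, E b] : Fin 4 → AbelianVariety ℂ)
          (Sum.elim (fun i => Fin.castSucc (Fin.castSucc i)) (fun c => if c = a then 2 else 3) (ρ l)) := funext fun l => sum_elim_eq_vec_four (ρ l) (hs l)
      rw [hfun]
      exact hodgeConjectureFor_biproduct_comp_vec_of_two_simpleThreefolds_two_absorbedCurves_of_markman hW4 h6₀ h6₁ (h2 a) (h2 b) hT₀ hT₁ (hE a) (hE b) hS₀
        hS₁ fa haK₁ fb _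
  · -- only `a ↪ K₀`
    obtain ⟨a, ⟨fa⟩⟩ := hex₀
    have hs : ∀ l c, ρ l = Sum.inr c → c = a := fun l c h => by
      rcases hρ l c h with hg | hg
      · exact eq_of_ringHom_of_ringHom_of_sextic h6₀ h2 hE hni hg.some fa
      · exact absurd ⟨c, hg⟩ hex₁
    have hfun : (fun l => (Sum.elim ![T₀, T₁] E (ρ l) : AbelianVariety ℂ)) =
        fun l => (![T₀, T₁, E a] : Fin 3 → AbelianVariety ℂ) (Sum.elim Fin.castSucc (fun _ => 2) (ρ l)) := funext fun l => sum_elim_eq_vec_three (ρ l) (hs l)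
    rw [hfun]
    exact hodgeConjectureFor_biproduct_comp_vec_of_any_two_simpleThreefolds_cmCurve_of_markman hW4 h6₀ h6₁ (h2 a) hT₀ hT₁ (hE a) hS₀ hS₁ _
  · -- only `b ↪ K₁`
    obtain ⟨b, ⟨fb⟩⟩ := hex₁
    have hs : ∀ l c, ρ l = Sum.inr c → c = b := fun l c h => by
      rcases hρ l c h with hg | hg
      · exact absurd ⟨c, hg⟩ hex₀
      · exact eq_of_ringHom_of_ringHom_of_sextic h6₁ h2 hE hni hg.some fb
    have hfun : (fun l => (Sum.elim ![T₀, T₁] E (ρ l) : AbelianVariety ℂ)) =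
        fun l => (![T₀, T₁, E b] : Fin 3 → AbelianVariety ℂ) (Sum.elim Fin.castSucc (fun _ => 2) (ρ l)) := funext fun l => sum_elim_eq_vec_three (ρ l) (hs l)
    rw [hfun]
    exact hodgeConjectureFor_biproduct_comp_vec_of_any_two_simpleThreefolds_cmCurve_of_markman hW4 h6₀ h6₁ (h2 b) hT₀ hT₁ (hE b) hS₀ hS₁ _
  · -- no distinguished curve: only the threefolds occur
    have hs : ∀ l c, ρ l ≠ Sum.inr c := fun l c h => by
      rcases hρ l c h with hg | hg
      · exact hex₀ ⟨c, hg⟩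
      · exact hex₁ ⟨c, hg⟩
    have hfun : (fun l => (Sum.elim ![T₀, T₁] E (ρ l) : AbelianVariety ℂ)) =
        fun l => (![T₀, T₁] : Fin 2 → AbelianVariety ℂ) (Sum.elim id (fun _ => 0) (ρ l)) := funext fun l => sum_elim_eq_vec_two (ρ l) (hs l)
    rw [hfun]
    exact hodgeConjectureFor_biproduct_comp_vec_of_any_two_simpleThreefolds_of_markman hW4 h6₀ h6₁ hT₀ hT₁ hS₀ hS₁ _

/-! ## §2 Two simple CM threefolds and pairwise non-isogenous CM elliptic curves -/

/-- **ANY TWO SIMPLE CM THREEFOLDS WITH ANY NUMBER OF PAIRWISE NON-ISOGENOUS CM ELLIPTIC CURVES — given ONLY Markman's fourfold theorem.**  `T₀ ⊨ (K₀; Φ₀)`, `T₁ ⊨ (K₁; Φ₁)`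
SIMPLE CM threefolds; `E_c ⊨ (k_c; Ψ_c)` (`c ∈ I`, finite) CM elliptic curves, NO TWO ISOGENOUS — nothing on the fields.  Then for every `π : Fin N → Fin 2 ⊕ I` the Hodge
conjecture holds for `⨁_j Sum.elim ![T₀, T₁] E (π j)` — every `T₀^a × T₁^b × ∏_c E_c^{n_c}`.  The curves whose fields embed in neither `K₀` nor `K₁` are FOREIGN to every
other member and split off (gen 33's `hodgeConjectureFor_prod_of_foreignCurves`); the rest is §1. [cite: MoonenZarhin1999LowDim, Thm. (0.1) (a), Thm. (0.2), §3 (3.1), Cor. (3.9)]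
[cite: Markman2025SurveySecant, Thm. 1.2] [cite: Gordon1999HodgeAVSurvey, §3 Theorem (proof), 7.5–7.7] -/
theorem hodgeConjectureFor_prod_two_simpleThreefolds_cmCurves_of_markman (hW4 : Markman2025_weilClasses_algebraic_abelianFourfold) (h6₀ : Module.finrank ℚ K₀ = 6)
    (h6₁ : Module.finrank ℚ K₁ = 6) (hT₀ : IsCMTypeRealisation Φ₀ T₀ ι₀ θ₀) (hT₁ : IsCMTypeRealisation Φ₁ T₁ ι₁ θ₁) (hS₀ : T₀.IsSimple) (hS₁ : T₁.IsSimple)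
    (h2 : ∀ a, Module.finrank ℚ (kq a) = 2) (hE : ∀ a, IsCMTypeRealisation (Ψ a) (E a) (ιE a) (θE a))
    (hni : ∀ a b, a ≠ b → ¬ AbelianVariety.IsIsogenous (E a) (E b)) {N : ℕ} (π : Fin N → Fin 2 ⊕ I) :
    HodgeConjectureFor (⨁ fun j => (Sum.elim ![T₀, T₁] E (π j) : AbelianVariety ℂ)).dim (⨁ fun j => (Sum.elim ![T₀, T₁] E (π j) : AbelianVariety ℂ)).X := by
  -- the fields of two distinct curves are not isomorphic
  have hkk : ∀ a b, a ≠ b → IsEmpty (kq a →+* kq b) := fun a b hab => ⟨fun f => by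
    obtain ⟨e⟩ := exists_ringEquiv_of_ringHom_of_finrank_eq f ((h2 a).trans (h2 b).symm)
    exact hni a b hab (isIsogenous_of_ringEquiv (h2 b) (hE b) (hE a) e).symm'⟩
  -- all curves distinguished: §1 directly
  by_cases hfor : ∃ a, IsEmpty (kq a →+* K₀) ∧ IsEmpty (kq a →+* K₁)
  swap
  · refine hodgeConjectureFor_prod_sum_of_forall_ringHom_of_markman hW4 h6₀ h6₁ hT₀ hT₁ hS₀ hS₁ h2 hE hni π fun l c _ => ?_
    by_contra h
    rw [not_or, not_nonempty_iff, not_nonempty_iff] at h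
    exact hfor ⟨c, h⟩
  obtain ⟨a₀, ha₀⟩ := hfor
  haveI : Nonempty I := ⟨a₀⟩
  -- the family over `Fin 2 ⊕ I`: `inl i ↦ (K_i, T_i)`, `inr c ↦ (k_c, E_c)` (all identifications below are definitional)
  let Kv : Fin 2 → Type := Fin.cons K₀ (Fin.cons K₁ finZeroElim)
  let fKv : ∀ i, Field (Kv i) := Fin.cons fK₀ (Fin.cons fK₁ finZeroElim)
  let nKv : ∀ i, NumberField (Kv i) := Fin.cons nK₀ (Fin.cons nK₁ finZeroElim)
  have cKv : ∀ i, IsCMField (Kv i) := Fin.cons cK₀ (Fin.cons cK₁ finZeroElim)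
  let Φv : ∀ i : Fin 2, CMType (Kv i) := Fin.cons Φ₀ (Fin.cons Φ₁ finZeroElim)
  let ιv : ∀ i : Fin 2, 𝓞 (Kv i) →+* End ((![T₀, T₁] : Fin 2 → AbelianVariety ℂ) i) := Fin.cons ι₀ (Fin.cons ι₁ finZeroElim)
  let θv : ∀ i : Fin 2, Kv i →+* Module.End ℂ (complexBetti ((![T₀, T₁] : Fin 2 → AbelianVariety ℂ) i).X 1) := Fin.cons θ₀ (Fin.cons θ₁ finZeroElim)
  have hAv : ∀ i, IsCMTypeRealisation (Φv i) ((![T₀, T₁] : Fin 2 → AbelianVariety ℂ) i) (ιv i) (θv i) := Fin.cons hT₀ (Fin.cons hT₁ finZeroElim)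
  let Kf : Fin 2 ⊕ I → Type := Sum.elim Kv kq
  letI instF : ∀ s, Field (Kf s) := fun s => @Sum.rec (Fin 2) I (fun s => Field (Sum.elim Kv kq s)) (fun i => fKv i) (fun a => fk a) s
  letI instN : ∀ s, NumberField (Kf s) := fun s => @Sum.rec (Fin 2) I (fun s => NumberField (Sum.elim Kv kq s)) (fun i => nKv i) (fun a => nk a) s
  haveI instC : ∀ s, IsCMField (Kf s) := fun s => @Sum.rec (Fin 2) I (fun s => IsCMField (Sum.elim Kv kq s)) (fun i => cKv i) (fun a => ck a) s
  let Φf : ∀ s, CMType (Kf s) := fun s => @Sum.rec (Fin 2) I (fun s => CMType (Sum.elim Kv kq s)) (fun i => Φv i) (fun a => Ψ a) s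
  let ιf : ∀ s, 𝓞 (Kf s) →+* End (Sum.elim ![T₀, T₁] E s : AbelianVariety ℂ) :=
    fun s => @Sum.rec (Fin 2) I (fun s => 𝓞 (Sum.elim Kv kq s) →+* End (Sum.elim ![T₀, T₁] E s : AbelianVariety ℂ)) (fun i => ιv i) (fun a => ιE a) s
  let θf : ∀ s, Kf s →+* Module.End ℂ (complexBetti (Sum.elim ![T₀, T₁] E s : AbelianVariety ℂ).X 1) :=
    fun s => @Sum.rec (Fin 2) I (fun s => Sum.elim Kv kq s →+* Module.End ℂ (complexBetti (Sum.elim ![T₀, T₁] E s : AbelianVariety ℂ).X 1)) (fun i => θv i)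
      (fun a => θE a) s
  have hA : ∀ s, IsCMTypeRealisation (Φf s) (Sum.elim ![T₀, T₁] E s : AbelianVariety ℂ) (ιf s) (θf s) := by
    rintro (i | a)
    · exact hAv i
    · exact hE a
  -- the marked slots: curves whose fields embed in neither `K₀` nor `K₁`
  refine @hodgeConjectureFor_prod_of_foreignCurves (Fin 2 ⊕ I) _ Kf instF instN instC Φf (fun s => (Sum.elim ![T₀, T₁] E s : AbelianVariety ℂ)) ιf θf hA
    (fun s => ∃ a, s = Sum.inr a ∧ IsEmpty (kq a →+* K₀) ∧ IsEmpty (kq a →+* K₁)) _ ?_ ?_ ⟨Sum.inr a₀, a₀, rfl, ha₀⟩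
    ⟨Sum.inl 0, by rintro ⟨a, h, -⟩; exact Sum.inl_ne_inr h⟩ ?_ ?_ N π
  · rintro _ ⟨a, rfl, -⟩
    exact h2 a
  · rintro _ t ⟨a, rfl, ha⟩ ht
    rcases t with i | b
    · fin_cases i
      · exact ha.1
      · exact ha.2
    · have hab : a ≠ b := by
        rintro rfl
        exact ht ⟨a, rfl, ha⟩
      exact hkk a b hab
  · -- products of copies of the foreign curves: pairwise non-isogenous CM elliptic curves (b16, unconditional)
    intro M ρ hρ
    choose a ha using hρ
    have hfun : (fun l => (Sum.elim ![T₀, T₁] E (ρ l) : AbelianVariety ℂ)) = fun l => E (a l) := funext fun l => by rw [(ha l).1]; rfl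
    rw [hfun]
    exact hodgeConjectureFor_prod_of_pairwise_not_isIsogenous h2 hE hni a
  · -- the rest block: §1
    intro M ρ hρ
    refine hodgeConjectureFor_prod_sum_of_forall_ringHom_of_markman hW4 h6₀ h6₁ hT₀ hT₁ hS₀ hS₁ h2 hE hni ρ fun l c h => ?_
    by_contra hc
    rw [not_or, not_nonempty_iff, not_nonempty_iff] at hc
    exact hρ l ⟨c, h, hc⟩

/-! ## §3 Any finite family of CM elliptic curves -/

/-- **MAIN THEOREM — ANY TWO SIMPLE CM THREEFOLDS AND ANY FINITE FAMILY OF CM ELLIPTIC CURVES, given ONLY Markman's fourfold theorem.**  `T₀ ⊨ (K₀; Φ₀)`, `T₁ ⊨ (K₁; Φ₁)`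
SIMPLE abelian threefolds with CM by sextic CM fields; `E_c ⊨ (k_c; Ψ_c)` (`c ∈ I`, finite) CM elliptic curves — isogenous or not, nothing assumed on any field.  Then
for every `π : Fin N → Fin 2 ⊕ I` the Hodge conjecture holds for `⨁_j Sum.elim ![T₀, T₁] E (π j)` — every `T₀^a × T₁^b × ∏_c E_c^{n_c}` — GIVEN ONLY
`Markman2025_weilClasses_algebraic_abelianFourfold` (one representative per isogeny class of curves, §2, then the isogeny).  `HC_CM` is NOT asserted.
[cite: MoonenZarhin1999LowDim, Thm. (0.1), Thm. (0.2), Cor. (3.9)] [cite: Markman2025SurveySecant, Thm. 1.2] [cite: MumfordAV1970, §19 Thm. 1 and p. 169] -/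
theorem hodgeConjectureFor_prod_two_simpleThreefolds_anyCurves_of_markman (hW4 : Markman2025_weilClasses_algebraic_abelianFourfold) (h6₀ : Module.finrank ℚ K₀ = 6)
    (h6₁ : Module.finrank ℚ K₁ = 6) (hT₀ : IsCMTypeRealisation Φ₀ T₀ ι₀ θ₀) (hT₁ : IsCMTypeRealisation Φ₁ T₁ ι₁ θ₁) (hS₀ : T₀.IsSimple) (hS₁ : T₁.IsSimple)
    (h2 : ∀ a, Module.finrank ℚ (kq a) = 2) (hE : ∀ a, IsCMTypeRealisation (Ψ a) (E a) (ιE a) (θE a)) {N : ℕ} (π : Fin N → Fin 2 ⊕ I) :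
    HodgeConjectureFor (⨁ fun j => (Sum.elim ![T₀, T₁] E (π j) : AbelianVariety ℂ)).dim (⨁ fun j => (Sum.elim ![T₀, T₁] E (π j) : AbelianVariety ℂ)).X := by
  -- an auxiliary linear order on `I`, and the least index of each isogeny class as its representative
  letI : LinearOrder I := LinearOrder.lift' (Fintype.equivFin I) (Fintype.equivFin I).injective
  let cl : I → Finset I := fun a => Finset.univ.filter fun b => AbelianVariety.IsIsogenous (E a) (E b)
  have hcl : ∀ a b, b ∈ cl a ↔ AbelianVariety.IsIsogenous (E a) (E b) := fun a b => by
    simp only [cl, Finset.mem_filter, Finset.mem_univ, true_and]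
  have hne : ∀ a, (cl a).Nonempty := fun a => ⟨a, (hcl a a).2 (AbelianVariety.IsIsogenous.refl (E a))⟩
  let r : I → I := fun a => (cl a).min' (hne a)
  have hr_iso : ∀ a, AbelianVariety.IsIsogenous (E a) (E (r a)) := fun a => (hcl a (r a)).1 (Finset.min'_mem _ (hne a))
  have hr_le : ∀ a b, AbelianVariety.IsIsogenous (E a) (E b) → r a ≤ r b := fun a b h =>
    Finset.min'_le (cl a) (r b) ((hcl a (r b)).2 (h.trans (hr_iso b)))
  have hr_eq : ∀ a b, AbelianVariety.IsIsogenous (E a) (E b) → r a = r b := fun a b h => le_antisymm (hr_le a b h) (hr_le b a h.symm')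
  have hr_idem : ∀ a, r (r a) = r a := fun a => (hr_eq a (r a) (hr_iso a)).symm
  -- the representatives, pairwise non-isogenous
  let J : Type := {b : I // r b = b}
  have hniJ : ∀ j j' : J, j ≠ j' → ¬ AbelianVariety.IsIsogenous (E j.1) (E j'.1) := fun j j' hne' h =>
    hne' (Subtype.ext (by rw [← j.2, ← j'.2]; exact hr_eq _ _ h))
  -- the product is isogenous, slot by slot, to the product over the representatives
  let ρ : I → J := fun a => ⟨r a, hr_idem a⟩
  have hiso : AbelianVariety.IsIsogenous (⨁ fun l => (Sum.elim ![T₀, T₁] E (π l) : AbelianVariety ℂ))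
      (⨁ fun l => (Sum.elim ![T₀, T₁] (fun j : J => E j.1) ((π l).map id ρ) : AbelianVariety ℂ)) := by
    refine AbelianVariety.IsIsogenous.biproduct fun l => ?_
    show AbelianVariety.IsIsogenous (Sum.elim ![T₀, T₁] E (π l)) (Sum.elim ![T₀, T₁] (fun j : J => E j.1) ((π l).map id ρ))
    rcases π l with i | a
    · exact AbelianVariety.IsIsogenous.refl _
    · exact hr_iso a
  exact Domination.hodgeConjectureFor_of_avDominatedBy
    (hodgeConjectureFor_prod_two_simpleThreefolds_cmCurves_of_markman (kq := fun j : J => kq j.1) (E := fun j : J => E j.1) (Ψ := fun j : J => Ψ j.1)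
      (ιE := fun j : J => ιE j.1) (θE := fun j : J => θE j.1) hW4 h6₀ h6₁ hT₀ hT₁ hS₀ hS₁ (fun j => h2 j.1) (fun j => hE j.1) hniJ fun l => (π l).map id ρ)
    (Domination.AVDominatedBy.of_isIsogenous hiso (Domination.AVDominatedBy.refl _))

/-- **Dominated form**: everything dominated by a product of copies of two simple CM threefolds and any CM elliptic curves (everything isogenous to such a product, every
abelian subvariety or quotient of one), given only Markman's fourfold theorem. [cite: MoonenZarhin1999LowDim, Thm. (0.1), (0.2)] [cite: Markman2025SurveySecant, Thm. 1.2]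
[cite: MumfordAV1970, §19 Thm. 1 and p. 169] -/
theorem hodgeConjectureFor_of_avDominatedBy_prod_two_simpleThreefolds_anyCurves_of_markman (hW4 : Markman2025_weilClasses_algebraic_abelianFourfold)
    (h6₀ : Module.finrank ℚ K₀ = 6) (h6₁ : Module.finrank ℚ K₁ = 6) (hT₀ : IsCMTypeRealisation Φ₀ T₀ ι₀ θ₀) (hT₁ : IsCMTypeRealisation Φ₁ T₁ ι₁ θ₁)
    (hS₀ : T₀.IsSimple) (hS₁ : T₁.IsSimple) (h2 : ∀ a, Module.finrank ℚ (kq a) = 2) (hE : ∀ a, IsCMTypeRealisation (Ψ a) (E a) (ιE a) (θE a)) {N : ℕ}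
    (π : Fin N → Fin 2 ⊕ I) {X : AbelianVariety ℂ} (hX : Domination.AVDominatedBy X (⨁ fun j => (Sum.elim ![T₀, T₁] E (π j) : AbelianVariety ℂ))) :
    HodgeConjectureFor X.dim X.X :=
  Domination.hodgeConjectureFor_of_avDominatedBy (hodgeConjectureFor_prod_two_simpleThreefolds_anyCurves_of_markman hW4 h6₀ h6₁ hT₀ hT₁ hS₀ hS₁ h2 hE π) hX

end TwoThreefoldsCurves

end Summit.HodgeConjecture.CorCM.MultiFieldWeil

end
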